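import Mathlib
import HarnessLib
import Literature.Analysis.FluidPDE.KNSSSwirlSupNonpos
import Summits.NavierStokesRegularity.NavierStokesRegularity.Theorems.HalfSpaceWindowDoorCirculationCarryingRigiditySubSwirlSpaceTime

/-!
# Route `HalfSpaceWindowDoor`, crux `CirculationCarryingRigidity` (stmt-NavierStokesRegularity-25311) — the ONE-SIDED
# eddy-torque engine, part 3b: absolute convergence of the KNSS space–time integrals (and of the one-sided source)

Line `eddy_torque` (LEAD ns-hsw-p1 g5).  For a swirl SUBSOLUTION pair (`…Defs.IsSubSwirl`) on `(−∞, τ')` and the KNSS cut-off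
`φ = φ_{L,T}`, `0 ≤ T < τ'`: the four KNSS integrands `(F−M)∂ₛφ`, `(F−M)(Dφ[V]+Δφ)`, `(2/r)FDφ[e_r]`, `G₀φ` and the one-sided
source integrand `(A/√(τ'−s))∂ᵣF φ` are absolutely convergent on `(0,T] × ℝ³` (`spaceTime_integrable`, verbatim from g3;
`spaceTime_integrable_source`); the sequel `…SubSwirlIdentity` turns them into the tested space–time INEQUALITY.

Seat ns-hsw-p1 g5 (LEAD of 25311, cell pub-ns-dss).  WHAT THIS IS NOT: not a statement about Navier–Stokes regularity (Clay A); a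
linear parabolic tool about HYPOTHETICAL blow-up profiles; helper `--supports` 25311.
-/

noncomputable section

-- the summit and its single sub-problem share the name (CONVENTIONS §1), as in every Theorems file
set_option linter.dupNamespace false

namespace Summit.NavierStokesRegularity.NavierStokesRegularity.Theorems.HalfSpaceWindowDoorCirculationCarryingRigiditySubSwirlIntegrable

open MeasureTheory Set Function Filter Topology TopologicalSpace InnerProductSpace WithLp Metric
open scoped Laplacian RealInnerProductSpace ContDiff
open Literature.Analysis Literature.Analysis.FluidPDE
open Summit.NavierStokesRegularity.NavierStokesRegularity.Theorems.HalfSpaceWindowDoorCirculationCarryingRigidityDefs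
open Summit.NavierStokesRegularity.NavierStokesRegularity.Theorems.HalfSpaceWindowDoorCirculationCarryingRigiditySubSwirl
open Summit.NavierStokesRegularity.NavierStokesRegularity.Theorems.HalfSpaceWindowDoorCirculationCarryingRigiditySubSwirl.IsSubSwirl
open Summit.NavierStokesRegularity.NavierStokesRegularity.Theorems.HalfSpaceWindowDoorCirculationCarryingRigiditySubSwirlSpaceTime.IsSubSwirl

namespace IsSubSwirl

variable {Cf Cu Cg A τ' : ℝ} {F : ℝ → (EuclideanSpace ℝ (Fin 3)) → ℝ}
  {V : ℝ → (EuclideanSpace ℝ (Fin 3)) → (EuclideanSpace ℝ (Fin 3))}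

/-- **Absolute convergence of the KNSS space–time integrals** (the tree's four integrands of
`IsKNSSSwirlPair.spaceTime_identity`, for a swirl subsolution pair; verbatim from g3's `…SourcedSwirlSpaceTime`, the inequalities are not used): on `(0,T] × ℝ³`, `T < τ'`, the integrands
`(F − M)∂ₛφ`, `(F − M)(Dφ[V] + Δφ)`, `(2/r) F Dφ[e_r]` and `G₀ φ` (`G₀ = swirlEqnIntegrand F V`) are integrable for the product
measure. -/
theorem spaceTime_integrable (hP : IsSubSwirl Cf Cu Cg A τ' F V) {L T : ℝ} (hTτ : T < τ') (M : ℝ) :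
    Integrable (fun p : ℝ × (EuclideanSpace ℝ (Fin 3)) => (F p.1 p.2 - M) * (psiCut L p.2 * deriv (zetaCut T) p.1))
      ((volume.restrict (Ioc 0 T)).prod volume) ∧
    Integrable (fun p : ℝ × (EuclideanSpace ℝ (Fin 3)) => (F p.1 p.2 - M) *
      (fderiv ℝ (phiCut L T p.1) p.2 (V p.1 p.2) + (Δ (phiCut L T p.1)) p.2))
      ((volume.restrict (Ioc 0 T)).prod volume) ∧
    Integrable (fun p : ℝ × (EuclideanSpace ℝ (Fin 3)) => 2 / cylRadius p.2 *
      (F p.1 p.2 * fderiv ℝ (phiCut L T p.1) p.2 (eR p.2))) ((volume.restrict (Ioc 0 T)).prod volume) ∧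
    Integrable (fun p : ℝ × (EuclideanSpace ℝ (Fin 3)) => swirlEqnIntegrand F V p.1 p.2 * phiCut L T p.1 p.2)
      ((volume.restrict (Ioc 0 T)).prod volume) := by
  set μT : Measure (ℝ × (EuclideanSpace ℝ (Fin 3))) := (volume.restrict (Ioc 0 T)).prod volume with hμT
  have hμT' : μT = (volume.prod volume).restrict (Ioc 0 T ×ˢ univ) :=
    Measure.restrict_prod_eq_prod_univ _
  have hslabm : MeasurableSet (Ioc (0 : ℝ) T ×ˢ (univ : Set (EuclideanSpace ℝ (Fin 3)))) :=
    measurableSet_Ioc.prod MeasurableSet.univ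
  have hsub : Ioc (0 : ℝ) T ×ˢ (univ : Set (EuclideanSpace ℝ (Fin 3))) ⊆ Iio τ' ×ˢ univ :=
    fun p hp => ⟨lt_of_le_of_lt hp.1.2 hTτ, mem_univ _⟩
  have hτ : ∀ s ∈ Ioc (0 : ℝ) T, s < τ' := fun s hs => lt_of_le_of_lt hs.2 hTτ
  have hae : ∀ᵐ p ∂μT, p.1 ∈ Ioc 0 T ∧ cylRadius p.2 ≠ 0 := by
    have h1 : ∀ᵐ p ∂μT, p ∈ Ioc (0 : ℝ) T ×ˢ (univ : Set (EuclideanSpace ℝ (Fin 3))) := by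
      rw [hμT']; exact ae_restrict_mem hslabm
    have h2 : ∀ᵐ p ∂μT, cylRadius p.2 ≠ 0 :=
      (Measure.quasiMeasurePreserving_snd (μ := volume.restrict (Ioc (0 : ℝ) T))
        (ν := (volume : Measure (EuclideanSpace ℝ (Fin 3))))).ae ae_cylRadius_ne_zero
    filter_upwards [h1, h2] with p hp1 hp2
    exact ⟨hp1.1, hp2⟩
  have hAE_cont : ∀ {g : ℝ × (EuclideanSpace ℝ (Fin 3)) → ℝ}, ContinuousOn g (Iio τ' ×ˢ univ) →
      AEStronglyMeasurable g μT := by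
    intro g hg
    rw [hμT']
    exact (hg.mono hsub).aestronglyMeasurable hslabm
  have happly : Continuous fun q : ((EuclideanSpace ℝ (Fin 3)) →L[ℝ] ℝ) × (EuclideanSpace ℝ (Fin 3)) => q.1 q.2 :=
    (isBoundedBilinearMap_apply (𝕜 := ℝ) (E := EuclideanSpace ℝ (Fin 3)) (F := ℝ)).continuous
  have hAE_DF : ∀ {v : ℝ × (EuclideanSpace ℝ (Fin 3)) → (EuclideanSpace ℝ (Fin 3))}, Measurable v →
      AEStronglyMeasurable (fun p : ℝ × (EuclideanSpace ℝ (Fin 3)) => fderiv ℝ (F p.1) p.2 (v p)) μT := by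
    intro v hv
    have h1 : AEStronglyMeasurable (fun p : ℝ × (EuclideanSpace ℝ (Fin 3)) => fderiv ℝ (F p.1) p.2) μT := by
      rw [hμT']
      exact (hP.continuousOn_fderiv.mono hsub).aestronglyMeasurable hslabm
    exact happly.comp_aestronglyMeasurable (h1.prodMk hv.aestronglyMeasurable)
  have hVm : Measurable fun p : ℝ × (EuclideanSpace ℝ (Fin 3)) => V p.1 p.2 := hP.measurable_drift
  have heRm : Measurable fun p : ℝ × (EuclideanSpace ℝ (Fin 3)) => eR p.2 := measurable_eR.comp measurable_snd
  have hFc : ContinuousOn (fun p : ℝ × (EuclideanSpace ℝ (Fin 3)) => F p.1 p.2 - M) (Iio τ' ×ˢ univ) :=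
    (continuousOn_uncurry hP).sub continuousOn_const
  have hζ'c : Continuous (deriv (zetaCut T)) := (contDiff_zetaCut T (n := 2)).continuous_deriv (by norm_num)
  have hψc : Continuous (psiCut L) := (contDiff_psiCut L (n := 0)).continuous
  have hDφc : Continuous fun p : ℝ × (EuclideanSpace ℝ (Fin 3)) => fderiv ℝ (phiCut L T p.1) p.2 := by
    have h : Continuous fun p : ℝ × (EuclideanSpace ℝ (Fin 3)) => zetaCut T p.1 • fderiv ℝ (psiCut L) p.2 :=
      ((contDiff_zetaCut T (n := 0)).continuous.comp continuous_fst).smul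
        (((contDiff_psiCut L (n := 1)).continuous_fderiv one_ne_zero).comp continuous_snd)
    exact h.congr fun p => (fderiv_phiCut_eq L T p.1 p.2).symm
  have hΔφc : Continuous fun p : ℝ × (EuclideanSpace ℝ (Fin 3)) => (Δ (phiCut L T p.1)) p.2 := by
    have h : Continuous fun p : ℝ × (EuclideanSpace ℝ (Fin 3)) => zetaCut T p.1 * (Δ (psiCut L)) p.2 :=
      ((contDiff_zetaCut T (n := 0)).continuous.comp continuous_fst).mul
        ((continuous_laplacian (contDiff_psiCut L (n := 2))).comp continuous_snd)
    exact h.congr fun p => (laplacian_phiCut_eq L T p.1 p.2).symm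
  have hφc : Continuous fun p : ℝ × (EuclideanSpace ℝ (Fin 3)) => phiCut L T p.1 p.2 :=
    (hψc.comp continuous_snd).mul ((contDiff_zetaCut T (n := 0)).continuous.comp continuous_fst)
  -- measurability
  -- the five integrands are a.e. strongly measurable
  have hm1 : AEStronglyMeasurable (fun p : ℝ × (EuclideanSpace ℝ (Fin 3)) => (F p.1 p.2 - M) *
      (psiCut L p.2 * deriv (zetaCut T) p.1)) μT :=
    (hAE_cont hFc).mul ((hψc.comp continuous_snd).mul (hζ'c.comp continuous_fst)).aestronglyMeasurable
  have hm2 : AEStronglyMeasurable (fun p : ℝ × (EuclideanSpace ℝ (Fin 3)) => (F p.1 p.2 - M) *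
      (fderiv ℝ (phiCut L T p.1) p.2 (V p.1 p.2) + (Δ (phiCut L T p.1)) p.2)) μT :=
    (hAE_cont hFc).mul ((happly.comp_aestronglyMeasurable
      (hDφc.aestronglyMeasurable.prodMk hVm.aestronglyMeasurable)).add hΔφc.aestronglyMeasurable)
  have hm3 : AEStronglyMeasurable (fun p : ℝ × (EuclideanSpace ℝ (Fin 3)) => 2 / cylRadius p.2 *
      (F p.1 p.2 * fderiv ℝ (phiCut L T p.1) p.2 (eR p.2))) μT := by
    have h1 : Measurable fun p : ℝ × (EuclideanSpace ℝ (Fin 3)) => 2 / cylRadius p.2 :=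
      measurable_const.div (continuous_cylRadius.measurable.comp measurable_snd)
    have h2 : AEStronglyMeasurable (fun p : ℝ × (EuclideanSpace ℝ (Fin 3)) => F p.1 p.2) μT :=
      hAE_cont (continuousOn_uncurry hP)
    exact h1.aestronglyMeasurable.mul (h2.mul (happly.comp_aestronglyMeasurable
      (hDφc.aestronglyMeasurable.prodMk heRm.aestronglyMeasurable)))
  have hm4 : AEStronglyMeasurable (fun p : ℝ × (EuclideanSpace ℝ (Fin 3)) => swirlEqnIntegrand F V p.1 p.2 *
      phiCut L T p.1 p.2) μT := by
    have h1 : AEStronglyMeasurable (fun p : ℝ × (EuclideanSpace ℝ (Fin 3)) => (Δ (F p.1)) p.2) μT := by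
      rw [hμT']; exact (hP.continuousOn_laplacian.mono hsub).aestronglyMeasurable hslabm
    have h2 := hAE_DF hVm
    have h3 := hAE_DF heRm
    have h4 : Measurable fun p : ℝ × (EuclideanSpace ℝ (Fin 3)) => 2 / cylRadius p.2 :=
      measurable_const.div (continuous_cylRadius.measurable.comp measurable_snd)
    have h : AEStronglyMeasurable (fun p : ℝ × (EuclideanSpace ℝ (Fin 3)) => ((Δ (F p.1)) p.2 - fderiv ℝ (F p.1) p.2 (V p.1 p.2)
        - 2 / cylRadius p.2 * fderiv ℝ (F p.1) p.2 (eR p.2)) * phiCut L T p.1 p.2) μT :=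
      ((h1.sub h2).sub (h4.aestronglyMeasurable.mul h3)).mul hφc.aestronglyMeasurable
    simpa only [swirlEqnIntegrand, partialDeriv_apply] using h
  -- bounds for `∇F`, `ΔF` on the compact `[0, T] × {r ≤ 2, |z| ≤ L}`
  have hKset : IsCompact (Icc (0 : ℝ) T ×ˢ solidCylinder 2 L) := isCompact_Icc.prod (isCompact_solidCylinder 2 L)
  have hKsub : Icc (0 : ℝ) T ×ˢ solidCylinder 2 L ⊆ Iio τ' ×ˢ univ :=
    fun p hp => ⟨lt_of_le_of_lt hp.1.2 hTτ, mem_univ _⟩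
  obtain ⟨K₁, hK₁⟩ := hKset.exists_bound_of_continuousOn (hP.continuousOn_fderiv.mono hKsub)
  obtain ⟨K₂, hK₂⟩ := hKset.exists_bound_of_continuousOn (hP.continuousOn_laplacian.mono hKsub)
  set K : ℝ := max (max K₁ K₂) 0 with hK
  have hK0 : 0 ≤ K := le_max_right _ _
  have hKD : ∀ s ∈ Ioc (0 : ℝ) T, ∀ y ∈ solidCylinder 2 L, ‖fderiv ℝ (F s) y‖ ≤ K := fun s hs y hy =>
    (hK₁ (s, y) ⟨⟨hs.1.le, hs.2⟩, hy⟩).trans ((le_max_left _ _).trans (le_max_left _ _))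
  have hKΔ : ∀ s ∈ Ioc (0 : ℝ) T, ∀ y ∈ solidCylinder 2 L, |(Δ (F s)) y| ≤ K := fun s hs y hy => by
    have h := hK₂ (s, y) ⟨⟨hs.1.le, hs.2⟩, hy⟩
    rw [Real.norm_eq_abs] at h
    exact h.trans ((le_max_right _ _).trans (le_max_left _ _))
  obtain ⟨Bφ, hB⟩ := exists_bound_fderiv_laplacian_phiCut L T
  have hB0 : 0 ≤ Bφ := (norm_nonneg _).trans (hB 0 0).1
  have hCf := Cf_nonneg hP
  have hCu := Cu_nonneg hP
  have hA := hP.A_nonneg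
  -- the dominating function (the tree's, enlarged by `A K` for the extra-drift term)
  set Kd : ℝ := (Cf + |M|) * (2 * smoothTransitionC2Bound + Bφ * (Cu + 1)) + 2 * Cf * Bφ + K * (Cu + 2) + 1
    with hKd
  have hKd0 : 0 ≤ Kd := by
    have := smoothTransitionC2Bound_nonneg
    positivity
  set D : ℝ × (EuclideanSpace ℝ (Fin 3)) → ℝ := fun p =>
    Kd * (solidCylinder 2 L).indicator (fun y => (cylRadius y)⁻¹ + 1) p.2 with hD
  have hDint : Integrable D μT := by
    have hg : Integrable (fun y : (EuclideanSpace ℝ (Fin 3)) =>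
        (solidCylinder 2 L).indicator (fun y => (cylRadius y)⁻¹ + 1) y) :=
      ((integrableOn_inv_cylRadius_solidCylinder 2 L).add (integrableOn_const (C := (1 : ℝ))
        (volume_solidCylinder_lt_top 2 L).ne)).integrable_indicator (measurableSet_solidCylinder 2 L)
    have hf : Integrable (fun _ : ℝ => Kd) (volume.restrict (Ioc (0 : ℝ) T)) :=
      integrableOn_const (C := Kd) measure_Ioc_lt_top.ne
    exact hf.mul_prod hg
  have hDval : ∀ p : ℝ × (EuclideanSpace ℝ (Fin 3)), p.2 ∈ solidCylinder 2 L →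
      D p = Kd * ((cylRadius p.2)⁻¹ + 1) := fun p hp => by
    simp only [hD, indicator_of_mem hp]
  have hDval' : ∀ p : ℝ × (EuclideanSpace ℝ (Fin 3)), p.2 ∉ solidCylinder 2 L → D p = 0 := fun p hp => by
    simp only [hD, indicator_of_notMem hp, mul_zero]
  have hFM : ∀ s ∈ Ioc (0 : ℝ) T, ∀ y, |F s y - M| ≤ Cf + |M| := fun s hs y =>
    (abs_sub _ _).trans (add_le_add (hP.abs_le s (hτ s hs) y) le_rfl)
  -- integrability
  -- integrability of the five integrands
  have hint1 : Integrable (fun p : ℝ × (EuclideanSpace ℝ (Fin 3)) => (F p.1 p.2 - M) *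
      (psiCut L p.2 * deriv (zetaCut T) p.1)) μT := by
    refine hDint.mono' hm1 (hae.mono fun p hp => ?_)
    obtain ⟨hs, -⟩ := hp
    by_cases hy : p.2 ∈ solidCylinder 2 L
    · rw [hDval p hy, Real.norm_eq_abs, abs_mul]
      have h1 := hFM p.1 hs p.2
      have h2 := abs_psiCut_mul_deriv_zetaCut_le L T p.1 p.2
      have hr : 0 ≤ (cylRadius p.2)⁻¹ := inv_nonneg.2 (cylRadius_nonneg _)
      have h3 : |F p.1 p.2 - M| * |psiCut L p.2 * deriv (zetaCut T) p.1| ≤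
          (Cf + |M|) * (2 * smoothTransitionC2Bound) :=
        mul_le_mul h1 h2 (abs_nonneg _) (by positivity)
      have h4 : (Cf + |M|) * (2 * smoothTransitionC2Bound) ≤ Kd := by
        have P1 : 0 ≤ (Cf + |M|) * (Bφ * (Cu + 1)) := by positivity
        have P2 : 0 ≤ 2 * Cf * Bφ := by positivity
        have P3 : 0 ≤ K * (Cu + 2) := by positivity
        rw [hKd]; nlinarith [P1, P2, P3]
      nlinarith [mul_nonneg hr (mul_nonneg (abs_nonneg (F p.1 p.2 - M))
        (abs_nonneg (psiCut L p.2 * deriv (zetaCut T) p.1)))]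
    · rw [hDval' p hy, (phiCut_derivs_eq_zero_of_not_mem (T := T) (s := p.1) hy).2.2.2]
      simp
  have hint2 : Integrable (fun p : ℝ × (EuclideanSpace ℝ (Fin 3)) => (F p.1 p.2 - M) *
      (fderiv ℝ (phiCut L T p.1) p.2 (V p.1 p.2) + (Δ (phiCut L T p.1)) p.2)) μT := by
    refine hDint.mono' hm2 (hae.mono fun p hp => ?_)
    obtain ⟨hs, hr0⟩ := hp
    by_cases hy : p.2 ∈ solidCylinder 2 L
    · rw [hDval p hy, Real.norm_eq_abs, abs_mul]
      have hr : 0 < cylRadius p.2 := lt_of_le_of_ne (cylRadius_nonneg _) (Ne.symm hr0)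
      have h1 := hFM p.1 hs p.2
      have hV : ‖V p.1 p.2‖ ≤ Cu * (cylRadius p.2)⁻¹ := by
        rw [← div_eq_mul_inv, le_div_iff₀ hr, mul_comm]; exact hP.drift_le p.1 (hτ p.1 hs) p.2
      have h2 : |fderiv ℝ (phiCut L T p.1) p.2 (V p.1 p.2) + (Δ (phiCut L T p.1)) p.2| ≤
          Bφ * (Cu * (cylRadius p.2)⁻¹) + Bφ := by
        refine (abs_add_le _ _).trans (add_le_add ?_ (hB p.1 p.2).2)
        rw [← Real.norm_eq_abs]
        exact ((fderiv ℝ (phiCut L T p.1) p.2).le_opNorm _).trans (mul_le_mul (hB p.1 p.2).1 hV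
          (norm_nonneg _) hB0)
      have h3 : |F p.1 p.2 - M| * |fderiv ℝ (phiCut L T p.1) p.2 (V p.1 p.2) + (Δ (phiCut L T p.1)) p.2| ≤
          (Cf + |M|) * (Bφ * (Cu * (cylRadius p.2)⁻¹) + Bφ) :=
        mul_le_mul h1 h2 (abs_nonneg _) (by positivity)
      have hri : 0 ≤ (cylRadius p.2)⁻¹ := inv_nonneg.2 (cylRadius_nonneg _)
      have h4 : (Cf + |M|) * (Bφ * (Cu * (cylRadius p.2)⁻¹) + Bφ) ≤ Kd * ((cylRadius p.2)⁻¹ + 1) := by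
        have hCS := smoothTransitionC2Bound_nonneg
        have Q1 : 0 ≤ (Cf + |M|) * Bφ * Cu := by positivity
        have Q2 : 0 ≤ (Cf + |M|) * Bφ * (cylRadius p.2)⁻¹ := by positivity
        have Q3 : 0 ≤ ((Cf + |M|) * (2 * smoothTransitionC2Bound) + 2 * Cf * Bφ + K * (Cu + 2) + 1) *
            ((cylRadius p.2)⁻¹ + 1) := by positivity
        rw [hKd]; nlinarith [Q1, Q2, Q3]
      linarith
    · rw [hDval' p hy, (phiCut_derivs_eq_zero_of_not_mem hy).2.1, (phiCut_derivs_eq_zero_of_not_mem hy).2.2.1]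
      simp
  have hint3 : Integrable (fun p : ℝ × (EuclideanSpace ℝ (Fin 3)) => 2 / cylRadius p.2 *
      (F p.1 p.2 * fderiv ℝ (phiCut L T p.1) p.2 (eR p.2))) μT := by
    refine hDint.mono' hm3 (hae.mono fun p hp => ?_)
    obtain ⟨hs, -⟩ := hp
    by_cases hy : p.2 ∈ solidCylinder 2 L
    · rw [hDval p hy, Real.norm_eq_abs, abs_mul, abs_mul, abs_div, abs_two,
        abs_of_nonneg (cylRadius_nonneg _), div_eq_mul_inv]
      have h1 : |F p.1 p.2| ≤ Cf := hP.abs_le p.1 (hτ p.1 hs) p.2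
      have h2 : |fderiv ℝ (phiCut L T p.1) p.2 (eR p.2)| ≤ Bφ := by
        rw [← Real.norm_eq_abs]
        exact ((fderiv ℝ (phiCut L T p.1) p.2).le_opNorm _).trans
          ((mul_le_of_le_one_right (norm_nonneg _) (norm_eR_le_one _)).trans (hB p.1 p.2).1)
      have hri : 0 ≤ (cylRadius p.2)⁻¹ := inv_nonneg.2 (cylRadius_nonneg _)
      have h3 : |F p.1 p.2| * |fderiv ℝ (phiCut L T p.1) p.2 (eR p.2)| ≤ Cf * Bφ :=
        mul_le_mul h1 h2 (abs_nonneg _) hCf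
      have h4 : 2 * (Cf * Bφ) ≤ Kd := by
        rw [hKd]; nlinarith [smoothTransitionC2Bound_nonneg, abs_nonneg M, mul_nonneg hB0 hCu,
          mul_nonneg hK0 hCu, mul_nonneg hCf hB0]
      nlinarith [mul_nonneg hri (mul_nonneg (abs_nonneg (F p.1 p.2)) (abs_nonneg (fderiv ℝ (phiCut L T p.1) p.2 (eR p.2))))]
    · rw [hDval' p hy, (phiCut_derivs_eq_zero_of_not_mem hy).2.1]
      simp
  have hint4 : Integrable (fun p : ℝ × (EuclideanSpace ℝ (Fin 3)) => swirlEqnIntegrand F V p.1 p.2 * phiCut L T p.1 p.2) μT := by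
    refine hDint.mono' hm4 (hae.mono fun p hp => ?_)
    obtain ⟨hs, hr0⟩ := hp
    by_cases hy : p.2 ∈ solidCylinder 2 L
    · rw [hDval p hy, Real.norm_eq_abs, abs_mul]
      have hr : 0 < cylRadius p.2 := lt_of_le_of_ne (cylRadius_nonneg _) (Ne.symm hr0)
      have hri : 0 ≤ (cylRadius p.2)⁻¹ := inv_nonneg.2 (cylRadius_nonneg _)
      have hV : ‖V p.1 p.2‖ ≤ Cu * (cylRadius p.2)⁻¹ := by
        rw [← div_eq_mul_inv, le_div_iff₀ hr, mul_comm]; exact hP.drift_le p.1 (hτ p.1 hs) p.2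
      obtain ⟨φ0, φ1⟩ := phiCut_mem_Icc L T p.1 p.2
      have hG : |swirlEqnIntegrand F V p.1 p.2| ≤ K + K * (Cu * (cylRadius p.2)⁻¹) +
          2 * (cylRadius p.2)⁻¹ * K := by
        simp only [swirlEqnIntegrand, partialDeriv_apply]
        refine (abs_sub _ _).trans (add_le_add ((abs_sub _ _).trans (add_le_add (hKΔ p.1 hs p.2 hy) ?_)) ?_)
        · rw [← Real.norm_eq_abs]
          exact ((fderiv ℝ (F p.1) p.2).le_opNorm _).trans (mul_le_mul (hKD p.1 hs p.2 hy) hV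
            (norm_nonneg _) hK0)
        · rw [abs_mul, abs_div, abs_two, abs_of_nonneg (cylRadius_nonneg _), div_eq_mul_inv,
            ← Real.norm_eq_abs]
          refine mul_le_mul_of_nonneg_left ?_ (by positivity)
          exact ((fderiv ℝ (F p.1) p.2).le_opNorm _).trans
            ((mul_le_of_le_one_right (norm_nonneg _) (norm_eR_le_one _)).trans (hKD p.1 hs p.2 hy))
      have h3 : |swirlEqnIntegrand F V p.1 p.2| * |phiCut L T p.1 p.2| ≤
          (K + K * (Cu * (cylRadius p.2)⁻¹) + 2 * (cylRadius p.2)⁻¹ * K) * 1 := by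
        refine mul_le_mul hG ?_ (abs_nonneg _) (by positivity)
        rw [abs_of_nonneg φ0]; exact φ1
      have h4 : (K + K * (Cu * (cylRadius p.2)⁻¹) + 2 * (cylRadius p.2)⁻¹ * K) * 1 ≤
          Kd * ((cylRadius p.2)⁻¹ + 1) := by
        have hCS := smoothTransitionC2Bound_nonneg
        have R1 : 0 ≤ K * Cu := by positivity
        have R2 : 0 ≤ ((Cf + |M|) * (2 * smoothTransitionC2Bound + Bφ * (Cu + 1)) + 2 * Cf * Bφ + 1) *
            ((cylRadius p.2)⁻¹ + 1) := by positivity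
        have R3 : 0 ≤ K * Cu * (cylRadius p.2)⁻¹ := by positivity
        rw [hKd]; nlinarith [R1, R2, R3]
      linarith
    · rw [hDval' p hy, (phiCut_derivs_eq_zero_of_not_mem hy).1]
      simp
  exact ⟨hint1, hint2, hint3, hint4⟩



/-- **Absolute convergence of the one-sided source space–time integral**: on `(0,T] × ℝ³`, `T < τ'`, the integrand
`(A/√(τ'−s)) ∂ᵣF φ` is integrable for the product measure (bounded by `(A/√(τ'−T)) ‖∇F‖_∞` on the cylinder carrying `φ`). -/
theorem spaceTime_integrable_source (hP : IsSubSwirl Cf Cu Cg A τ' F V) {L T : ℝ} (hTτ : T < τ') :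
    Integrable (fun p : ℝ × (EuclideanSpace ℝ (Fin 3)) =>
      A / Real.sqrt (τ' - p.1) * fderiv ℝ (F p.1) p.2 (eR p.2) * phiCut L T p.1 p.2)
      ((volume.restrict (Ioc 0 T)).prod volume) := by
  set μT : Measure (ℝ × (EuclideanSpace ℝ (Fin 3))) := (volume.restrict (Ioc 0 T)).prod volume with hμT
  have hμT' : μT = (volume.prod volume).restrict (Ioc 0 T ×ˢ univ) :=
    Measure.restrict_prod_eq_prod_univ _
  have hslabm : MeasurableSet (Ioc (0 : ℝ) T ×ˢ (univ : Set (EuclideanSpace ℝ (Fin 3)))) :=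
    measurableSet_Ioc.prod MeasurableSet.univ
  have hsub : Ioc (0 : ℝ) T ×ˢ (univ : Set (EuclideanSpace ℝ (Fin 3))) ⊆ Iio τ' ×ˢ univ :=
    fun p hp => ⟨lt_of_le_of_lt hp.1.2 hTτ, mem_univ _⟩
  have hτ : ∀ s ∈ Ioc (0 : ℝ) T, s < τ' := fun s hs => lt_of_le_of_lt hs.2 hTτ
  have hae : ∀ᵐ p ∂μT, p.1 ∈ Ioc 0 T := by
    have h1 : ∀ᵐ p ∂μT, p ∈ Ioc (0 : ℝ) T ×ˢ (univ : Set (EuclideanSpace ℝ (Fin 3))) := by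
      rw [hμT']; exact ae_restrict_mem hslabm
    filter_upwards [h1] with p hp1
    exact hp1.1
  have happly : Continuous fun q : ((EuclideanSpace ℝ (Fin 3)) →L[ℝ] ℝ) × (EuclideanSpace ℝ (Fin 3)) => q.1 q.2 :=
    (isBoundedBilinearMap_apply (𝕜 := ℝ) (E := EuclideanSpace ℝ (Fin 3)) (F := ℝ)).continuous
  have heRm : Measurable fun p : ℝ × (EuclideanSpace ℝ (Fin 3)) => eR p.2 := measurable_eR.comp measurable_snd
  have hDFm : AEStronglyMeasurable (fun p : ℝ × (EuclideanSpace ℝ (Fin 3)) => fderiv ℝ (F p.1) p.2 (eR p.2)) μT := by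
    have h1 : AEStronglyMeasurable (fun p : ℝ × (EuclideanSpace ℝ (Fin 3)) => fderiv ℝ (F p.1) p.2) μT := by
      rw [hμT']
      exact (hP.continuousOn_fderiv.mono hsub).aestronglyMeasurable hslabm
    exact happly.comp_aestronglyMeasurable (h1.prodMk heRm.aestronglyMeasurable)
  have hsqm : Measurable fun p : ℝ × (EuclideanSpace ℝ (Fin 3)) => A / Real.sqrt (τ' - p.1) :=
    measurable_const.div ((measurable_const.sub measurable_fst).sqrt)
  have hψc : Continuous (psiCut L) := (contDiff_psiCut L (n := 0)).continuous
  have hφc : Continuous fun p : ℝ × (EuclideanSpace ℝ (Fin 3)) => phiCut L T p.1 p.2 :=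
    (hψc.comp continuous_snd).mul ((contDiff_zetaCut T (n := 0)).continuous.comp continuous_fst)
  have hm5 : AEStronglyMeasurable (fun p : ℝ × (EuclideanSpace ℝ (Fin 3)) =>
      A / Real.sqrt (τ' - p.1) * fderiv ℝ (F p.1) p.2 (eR p.2) * phiCut L T p.1 p.2) μT :=
    (hsqm.aestronglyMeasurable.mul hDFm).mul hφc.aestronglyMeasurable
  -- a bound for `∇F` on the compact `[0, T] × {r ≤ 2, |z| ≤ L}`
  have hKset : IsCompact (Icc (0 : ℝ) T ×ˢ solidCylinder 2 L) := isCompact_Icc.prod (isCompact_solidCylinder 2 L)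
  have hKsub : Icc (0 : ℝ) T ×ˢ solidCylinder 2 L ⊆ Iio τ' ×ˢ univ :=
    fun p hp => ⟨lt_of_le_of_lt hp.1.2 hTτ, mem_univ _⟩
  obtain ⟨K₁, hK₁⟩ := hKset.exists_bound_of_continuousOn (hP.continuousOn_fderiv.mono hKsub)
  set K : ℝ := max K₁ 0 with hK
  have hK0 : 0 ≤ K := le_max_right _ _
  have hKD : ∀ s ∈ Ioc (0 : ℝ) T, ∀ y ∈ solidCylinder 2 L, ‖fderiv ℝ (F s) y‖ ≤ K := fun s hs y hy =>
    (hK₁ (s, y) ⟨⟨hs.1.le, hs.2⟩, hy⟩).trans (le_max_left _ _)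
  have hA := hP.A_nonneg
  -- the source coefficient is bounded on `(0, T]`: `A/√(τ'−s) ≤ A/√(τ'−T)`
  have hsT : 0 < Real.sqrt (τ' - T) := Real.sqrt_pos.2 (by linarith)
  have hcoef : ∀ s ∈ Ioc (0 : ℝ) T, 0 ≤ A / Real.sqrt (τ' - s) ∧ A / Real.sqrt (τ' - s) ≤ A / Real.sqrt (τ' - T) := by
    intro s hs
    refine ⟨div_nonneg hA (Real.sqrt_nonneg _), div_le_div_of_nonneg_left hA hsT (Real.sqrt_le_sqrt (by linarith [hs.2]))⟩
  set D : ℝ × (EuclideanSpace ℝ (Fin 3)) → ℝ := fun p =>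
    A / Real.sqrt (τ' - T) * K * (solidCylinder 2 L).indicator (fun _ => (1 : ℝ)) p.2 with hD
  have hDint : Integrable D μT := by
    have hg : Integrable (fun y : (EuclideanSpace ℝ (Fin 3)) => (solidCylinder 2 L).indicator (fun _ => (1 : ℝ)) y) :=
      (integrableOn_const (C := (1 : ℝ)) (volume_solidCylinder_lt_top 2 L).ne).integrable_indicator
        (measurableSet_solidCylinder 2 L)
    have hf : Integrable (fun _ : ℝ => A / Real.sqrt (τ' - T) * K) (volume.restrict (Ioc (0 : ℝ) T)) :=
      integrableOn_const (C := A / Real.sqrt (τ' - T) * K) measure_Ioc_lt_top.ne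
    exact hf.mul_prod hg
  refine hDint.mono' hm5 (hae.mono fun p hs => ?_)
  by_cases hy : p.2 ∈ solidCylinder 2 L
  · simp only [hD, indicator_of_mem hy, mul_one]
    obtain ⟨φ0, φ1⟩ := phiCut_mem_Icc L T p.1 p.2
    obtain ⟨c0, c1⟩ := hcoef p.1 hs
    have hD' : |fderiv ℝ (F p.1) p.2 (eR p.2)| ≤ K := by
      rw [← Real.norm_eq_abs]
      exact ((fderiv ℝ (F p.1) p.2).le_opNorm _).trans
        ((mul_le_of_le_one_right (norm_nonneg _) (norm_eR_le_one _)).trans (hKD p.1 hs p.2 hy))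
    rw [Real.norm_eq_abs, abs_mul, abs_mul, abs_of_nonneg c0, abs_of_nonneg φ0]
    calc A / Real.sqrt (τ' - p.1) * |fderiv ℝ (F p.1) p.2 (eR p.2)| * phiCut L T p.1 p.2
        ≤ A / Real.sqrt (τ' - T) * K * 1 :=
          mul_le_mul (mul_le_mul c1 hD' (abs_nonneg _) (div_nonneg hA hsT.le)) φ1 φ0 (by positivity)
      _ = A / Real.sqrt (τ' - T) * K := by ring
  · simp only [hD, indicator_of_notMem hy, mul_zero]
    rw [(phiCut_derivs_eq_zero_of_not_mem (T := T) (s := p.1) hy).1]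
    simp

end IsSubSwirl

end Summit.NavierStokesRegularity.NavierStokesRegularity.Theorems.HalfSpaceWindowDoorCirculationCarryingRigiditySubSwirlIntegrable

end
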